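import Literature.Analysis.FluidPDE.GaussianVortexFormDomainMoment
import Literature.Analysis.FluidPDE.PlanarHardyInequality
import Literature.Analysis.FluidPDE.GaussianVortexPlanarProofs
import Literature.Analysis.FluidPDE.BiotSavart2DSymmetry
import HarnessLib

/-!
# The Biot–Savart velocity of a vorticity `w = ρ_λ u`, `(u, ∇u) ∈ H¹(μ_λ)`: absolute convergence and an `L^∞` bound

Analysis/FluidPDE file (all results proved, no definitions, no named facts), part of the theory
behind the named fact `GallayMaekawa2016_thm41` (Gallay–Maekawa 2016, Thm. 4.1): the nonlinear
term of (4.2) is `(v·∇)ω` with `v = K_{2D} ∗ ω`. For vorticities of the form `w = ρ_λ u` with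
`U = (u, ∇u)` in the form domain `H¹(μ_λ)` (`GaussianVortexFormDomain`) we show, WITHOUT any
`Lᵖ` (`p > 2`) Sobolev embedding:

* `integral_sq_weight_div_norm_sub_le_graph` — for a test function `φ`,
  `∫ (ρ_λφ)²/|y − x₀| dy ≤ B(‖φ‖, ‖∇φ‖)` with an explicit function `B` of the two `L²(μ_λ)` norms
  (planar Hardy inequality `integral_sq_div_norm_sub_le` for `ρ_λφ ∈ C¹_c`, `‖D(ρ_λφ)‖² ≤
  2ρ_λ(‖Dφ‖² + |x|²φ²)` and the moment bound);
* `integral_sq_weight_div_norm_sub_le_of_mem` — **the same bound on `H¹(μ_λ)`** (Fatou along an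
  a.e.-convergent subsequence, `lintegral_weight_mul_sq_le_of_tendsto_Lp`): for `U ∈ H¹(μ_λ)`
  and every `x₀`, `(ρ_λu)²/|y − x₀|` is integrable with `∫ ≤ B(‖u‖, ‖∇u‖) ≤ C_λ ‖U‖²`;
* `integrable_weight_mul_smul_biotSavartKernel2D`, `norm_biotSavart2D_weight_mul_le` — **the
  Biot–Savart integral `∫ w(y) K_{2D}(x₀ − y) dy`, `w = ρ_λ u`, converges absolutely at EVERY
  point and `‖(K_{2D} ∗ w)(x₀)‖ ≤ C_λ ‖U‖_{H¹(μ_λ)}`** (pointwise AM–GM `|w|/r ≤ (t w²/r + t⁻¹/r)/2`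
  on the unit disc about `x₀`, `∫_{B₁}|z|⁻¹ < ∞`, and `‖w‖_{L¹} ≤ μ_λ(ℝ²)^{1/2}‖u‖` outside).

## References

* Th. Gallay, Y. Maekawa, *Existence and stability of viscous vortices*, arXiv:1610.08384, §4.1,
  (4.2). [GallayMaekawa2016]
-/

open MeasureTheory Filter Set WithLp Metric
open scoped Real RealInnerProductSpace Topology InnerProductSpace ContDiff ENNReal

noncomputable section

namespace Literature.Analysis.FluidPDE

open Literature.Analysis.UnboundedOperators

/-! ### The weight `ρ_λ`: `ρ_λ ≤ 1`, `Dρ_λ = −ρ_λ Dq_λ`, `‖Dq_λ(y)‖ ≤ |y|` -/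

section Weight

variable {lam : ℝ} (hlam : lam ∈ Set.Ico (0 : ℝ) 1)
include hlam

/-- `ρ_λ ≤ 1`. [folklore] -/
theorem expNegQuadLam_le_one (x : EuclideanSpace ℝ (Fin 2)) :
    Real.exp (-((1 + lam) / 4 * x 0 ^ 2 + (1 - lam) / 4 * x 1 ^ 2)) ≤ 1 := by
  obtain ⟨hl0, hl1⟩ := hlam
  rw [Real.exp_le_one_iff, neg_nonpos]
  have : 0 ≤ 1 - lam := by linarith
  positivity

/-- `‖Dq_λ(y)‖ ≤ |y|` for `0 ≤ λ < 1`, `q_λ(y) = (1+λ)y₀²/4 + (1−λ)y₁²/4`. [folklore] -/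
theorem norm_fderiv_quadraticLam_le (x : EuclideanSpace ℝ (Fin 2)) :
    ‖fderiv ℝ (fun y : EuclideanSpace ℝ (Fin 2) =>
        (1 + lam) / 4 * y 0 ^ 2 + (1 - lam) / 4 * y 1 ^ 2) x‖ ≤ ‖x‖ := by
  obtain ⟨hl0, hl1⟩ := hlam
  rw [(hasFDerivAt_quadraticLam lam x).fderiv]
  refine ContinuousLinearMap.opNorm_le_bound _ (norm_nonneg _) fun v => ?_
  have hx0 : |x 0| ≤ ‖x‖ := by simpa [Real.norm_eq_abs] using PiLp.norm_apply_le x 0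
  have hx1 : |x 1| ≤ ‖x‖ := by simpa [Real.norm_eq_abs] using PiLp.norm_apply_le x 1
  have hv0 : |v 0| ≤ ‖v‖ := by simpa [Real.norm_eq_abs] using PiLp.norm_apply_le v 0
  have hv1 : |v 1| ≤ ‖v‖ := by simpa [Real.norm_eq_abs] using PiLp.norm_apply_le v 1
  have hp0 : |x 0 * v 0| ≤ ‖x‖ * ‖v‖ := by
    rw [abs_mul]; exact mul_le_mul hx0 hv0 (abs_nonneg _) (norm_nonneg _)
  have hp1 : |x 1 * v 1| ≤ ‖x‖ * ‖v‖ := by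
    rw [abs_mul]; exact mul_le_mul hx1 hv1 (abs_nonneg _) (norm_nonneg _)
  obtain ⟨hp0l, hp0r⟩ := abs_le.1 hp0
  obtain ⟨hp1l, hp1r⟩ := abs_le.1 hp1
  have hAv : (((1 + lam) / 4 * (2 * x 0)) •
        (EuclideanSpace.proj 0 : EuclideanSpace ℝ (Fin 2) →L[ℝ] ℝ) +
      ((1 - lam) / 4 * (2 * x 1)) •
        (EuclideanSpace.proj 1 : EuclideanSpace ℝ (Fin 2) →L[ℝ] ℝ)) v =
      (1 + lam) / 2 * (x 0 * v 0) + (1 - lam) / 2 * (x 1 * v 1) := by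
    simp only [add_apply, FunLike.coe_smul, Pi.smul_apply, smul_eq_mul]
    simp
    ring
  rw [hAv, Real.norm_eq_abs, abs_le]
  have hc0 : (0 : ℝ) ≤ (1 + lam) / 2 := by linarith
  have hc1 : (0 : ℝ) ≤ (1 - lam) / 2 := by linarith
  constructor
  · nlinarith [mul_le_mul_of_nonneg_left hp0l hc0, mul_le_mul_of_nonneg_left hp1l hc1]
  · nlinarith [mul_le_mul_of_nonneg_left hp0r hc0, mul_le_mul_of_nonneg_left hp1r hc1]

/-- **`‖D(ρ_λφ)(y)‖ ≤ ρ_λ(y)(‖Dφ(y)‖ + |y| |φ(y)|)`** for differentiable `φ`. [folklore] -/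
theorem norm_fderiv_weight_mul_le {φ : EuclideanSpace ℝ (Fin 2) → ℝ} (hφ : Differentiable ℝ φ)
    (y : EuclideanSpace ℝ (Fin 2)) :
    ‖fderiv ℝ (fun z : EuclideanSpace ℝ (Fin 2) =>
        Real.exp (-((1 + lam) / 4 * z 0 ^ 2 + (1 - lam) / 4 * z 1 ^ 2)) * φ z) y‖ ≤
      Real.exp (-((1 + lam) / 4 * y 0 ^ 2 + (1 - lam) / 4 * y 1 ^ 2)) *
        (‖fderiv ℝ φ y‖ + ‖y‖ * |φ y|) := by
  have hρd := hasFDerivAt_exp_neg_quadraticLam lam y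
  have hφd := (hφ y).hasFDerivAt
  rw [(hρd.fun_mul hφd).fderiv]
  set ρy := Real.exp (-((1 + lam) / 4 * y 0 ^ 2 + (1 - lam) / 4 * y 1 ^ 2)) with hρy
  have hρpos : 0 < ρy := Real.exp_pos _
  have hq := norm_fderiv_quadraticLam_le hlam y
  rw [(hasFDerivAt_quadraticLam lam y).fderiv] at hq
  calc ‖ρy • fderiv ℝ φ y + φ y • (ρy • -((((1 + lam) / 4 * (2 * y 0)) •
          (EuclideanSpace.proj 0 : EuclideanSpace ℝ (Fin 2) →L[ℝ] ℝ) +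
        ((1 - lam) / 4 * (2 * y 1)) •
          (EuclideanSpace.proj 1 : EuclideanSpace ℝ (Fin 2) →L[ℝ] ℝ))))‖
      ≤ ‖ρy • fderiv ℝ φ y‖ + ‖φ y • (ρy • -((((1 + lam) / 4 * (2 * y 0)) •
          (EuclideanSpace.proj 0 : EuclideanSpace ℝ (Fin 2) →L[ℝ] ℝ) +
        ((1 - lam) / 4 * (2 * y 1)) •
          (EuclideanSpace.proj 1 : EuclideanSpace ℝ (Fin 2) →L[ℝ] ℝ))))‖ := norm_add_le _ _
    _ ≤ ρy * ‖fderiv ℝ φ y‖ + |φ y| * (ρy * ‖y‖) := by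
        rw [norm_smul, norm_smul, norm_smul, norm_neg, Real.norm_of_nonneg hρpos.le,
          Real.norm_eq_abs]
        gcongr
    _ = ρy * (‖fderiv ℝ φ y‖ + ‖y‖ * |φ y|) := by ring

end Weight

/-! ### The Hardy bound for `ρ_λ φ`, `φ` a test function -/

section Hardy

variable {lam : ℝ} (hlam : lam ∈ Set.Ico (0 : ℝ) 1)
include hlam

/-- **Hardy bound for `w = ρ_λφ`, `φ ∈ C_c^∞`**: for every centre `x₀`, `(ρ_λφ)²/|y − x₀|` is
integrable and
`∫ (ρ_λφ)²/|y − x₀| ≤ 2‖φ‖ (2(‖∇φ‖² + (16/(1−λ)²)‖∇φ‖² + (8/(1−λ))‖φ‖²))^{1/2}`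
(norms in `L²(μ_λ)`), from `integral_sq_div_norm_sub_le`, `ρ_λ ≤ 1`,
`‖D(ρ_λφ)‖ ≤ ρ_λ(‖Dφ‖ + |y||φ|)` and the moment bound. [folklore] -/
theorem integral_sq_weight_div_norm_sub_le_graph (φ : planarTestFunctions) (x₀ : EuclideanSpace ℝ (Fin 2)) :
    Integrable (fun y : EuclideanSpace ℝ (Fin 2) =>
        (Real.exp (-((1 + lam) / 4 * y 0 ^ 2 + (1 - lam) / 4 * y 1 ^ 2)) *
          (φ : EuclideanSpace ℝ (Fin 2) → ℝ) y) ^ 2 / ‖y - x₀‖) ∧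
      ∫ y : EuclideanSpace ℝ (Fin 2),
          (Real.exp (-((1 + lam) / 4 * y 0 ^ 2 + (1 - lam) / 4 * y 1 ^ 2)) *
            (φ : EuclideanSpace ℝ (Fin 2) → ℝ) y) ^ 2 / ‖y - x₀‖ ≤
        2 * ‖(gaussLamGraph lam φ).fst‖ * Real.sqrt (2 * (‖(gaussLamGraph lam φ).snd‖ ^ 2 +
          (16 / (1 - lam) ^ 2 * ‖(gaussLamGraph lam φ).snd‖ ^ 2 +
            8 / (1 - lam) * ‖(gaussLamGraph lam φ).fst‖ ^ 2))) := by
  have hq : 0 < 1 - lam := by linarith [hlam.2]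
  set ρ : EuclideanSpace ℝ (Fin 2) → ℝ := fun y =>
    Real.exp (-((1 + lam) / 4 * y 0 ^ 2 + (1 - lam) / 4 * y 1 ^ 2)) with hρ_def
  set ψ : EuclideanSpace ℝ (Fin 2) → ℝ := (φ : EuclideanSpace ℝ (Fin 2) → ℝ) with hψ
  have hρpos : ∀ y, 0 < ρ y := fun y => Real.exp_pos _
  have hρle : ∀ y, ρ y ≤ 1 := expNegQuadLam_le_one hlam
  have hρc : Continuous ρ := continuous_expNegQuadLam lam
  have hψc : ContDiff ℝ ∞ ψ := planarTestFunctions.contDiff φ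
  have hψs : HasCompactSupport ψ := planarTestFunctions.hasCompactSupport φ
  have hψd : Differentiable ℝ ψ := hψc.differentiable (by simp)
  -- `w = ρψ ∈ C¹_c`
  set w : EuclideanSpace ℝ (Fin 2) → ℝ := fun y => ρ y * ψ y with hw_def
  have hw : ContDiff ℝ 1 w := (contDiff_exp_neg_quadraticLam lam (n := 1)).mul (hψc.of_le (by simp))
  have hwc : HasCompactSupport w := hψs.mul_left
  obtain ⟨hint, hle⟩ := integral_sq_div_norm_sub_le hw hwc x₀
  refine ⟨hint, hle.trans ?_⟩
  -- `∫ w² ≤ ‖φ‖²`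
  have hsupp : ∀ {G : EuclideanSpace ℝ (Fin 2) → ℝ}, (∀ x, ψ x = 0 → G x = 0) → HasCompactSupport G :=
    fun hG => hψs.mono (by
      intro x hx
      simp only [Function.mem_support, ne_eq] at hx ⊢
      contrapose! hx
      exact hG x hx)
  have iw2 : Integrable fun y => w y ^ 2 :=
    (hw.continuous.pow 2).integrable_of_hasCompactSupport (hsupp fun x hx => by simp [hw_def, hx])
  have iN : Integrable fun y => ψ y ^ 2 * ρ y :=
    ((hψc.continuous.pow 2).mul hρc).integrable_of_hasCompactSupport (hsupp fun x hx => by simp [hx])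
  have h1 : ∫ y, w y ^ 2 ≤ ‖(gaussLamGraph lam φ).fst‖ ^ 2 := by
    rw [norm_sq_gaussLamGraph_fst]
    refine integral_mono iw2 iN fun y => ?_
    show (ρ y * ψ y) ^ 2 ≤ ψ y ^ 2 * ρ y
    have := mul_le_mul_of_nonneg_left (hρle y) (mul_nonneg (sq_nonneg (ψ y)) (hρpos y).le)
    nlinarith [this]
  -- `∫ ‖Dw‖² ≤ 2 (‖∇φ‖² + moment)`
  have iD : Integrable fun y => ‖fderiv ℝ ψ y‖ ^ 2 * ρ y := by
    refine (((hψc.continuous_fderiv (by simp)).norm.pow 2).mul hρc).integrable_of_hasCompactSupport ?_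
    refine (hψs.fderiv (𝕜 := ℝ)).mono ?_
    intro x hx
    simp only [Function.mem_support, ne_eq] at hx ⊢
    contrapose! hx
    simp [hx]
  have iX : Integrable fun y : EuclideanSpace ℝ (Fin 2) => ‖y‖ ^ 2 * ψ y ^ 2 * ρ y :=
    (((continuous_norm.pow 2).mul (hψc.continuous.pow 2)).mul hρc).integrable_of_hasCompactSupport
      (hsupp fun x hx => by simp [hx])
  have iDw : Integrable fun y => ‖fderiv ℝ w y‖ ^ 2 := by
    refine ((hw.continuous_fderiv (by simp)).norm.pow 2).integrable_of_hasCompactSupport ?_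
    refine ((hwc.fderiv (𝕜 := ℝ)).norm).mono ?_
    intro x hx
    simp only [Function.mem_support, ne_eq] at hx ⊢
    contrapose! hx
    simp [hx]
  have hpt : ∀ y, ‖fderiv ℝ w y‖ ^ 2 ≤
      2 * (‖fderiv ℝ ψ y‖ ^ 2 * ρ y) + 2 * (‖y‖ ^ 2 * ψ y ^ 2 * ρ y) := by
    intro y
    have hb : ‖fderiv ℝ w y‖ ≤ ρ y * (‖fderiv ℝ ψ y‖ + ‖y‖ * |ψ y|) :=
      norm_fderiv_weight_mul_le hlam hψd y
    have hsq : ‖fderiv ℝ w y‖ ^ 2 ≤ (ρ y * (‖fderiv ℝ ψ y‖ + ‖y‖ * |ψ y|)) ^ 2 :=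
      pow_le_pow_left₀ (norm_nonneg _) hb 2
    have hρ2 : ρ y ^ 2 ≤ ρ y := by nlinarith [hρle y, hρpos y]
    set a := ‖fderiv ℝ ψ y‖ with ha
    set b := ‖y‖ * |ψ y| with hb_def
    have hab : (a + b) ^ 2 ≤ 2 * a ^ 2 + 2 * b ^ 2 := by nlinarith [sq_nonneg (a - b)]
    calc ‖fderiv ℝ w y‖ ^ 2 ≤ (ρ y * (a + b)) ^ 2 := hsq
      _ = ρ y ^ 2 * (a + b) ^ 2 := by ring
      _ ≤ ρ y * (2 * a ^ 2 + 2 * b ^ 2) :=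
          mul_le_mul hρ2 hab (sq_nonneg _) (hρpos y).le
      _ = 2 * (a ^ 2 * ρ y) + 2 * (‖y‖ ^ 2 * ψ y ^ 2 * ρ y) := by
          rw [hb_def, mul_pow, sq_abs]; ring
  have hmom := integral_norm_sq_mul_sq_mul_expNegQuadLam_le hlam φ
  have h2 : ∫ y, ‖fderiv ℝ w y‖ ^ 2 ≤ 2 * (‖(gaussLamGraph lam φ).snd‖ ^ 2 +
      (16 / (1 - lam) ^ 2 * ‖(gaussLamGraph lam φ).snd‖ ^ 2 +
        8 / (1 - lam) * ‖(gaussLamGraph lam φ).fst‖ ^ 2)) := by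
    have iS : Integrable fun y : EuclideanSpace ℝ (Fin 2) =>
        2 * (‖fderiv ℝ ψ y‖ ^ 2 * ρ y) + 2 * (‖y‖ ^ 2 * ψ y ^ 2 * ρ y) :=
      (iD.const_mul 2).add (iX.const_mul 2)
    have hI := integral_mono iDw iS hpt
    rw [integral_add (iD.const_mul 2) (iX.const_mul 2), integral_const_mul, integral_const_mul] at hI
    rw [norm_sq_gaussLamGraph_snd, norm_sq_gaussLamGraph_fst]
    nlinarith [hI, hmom]
  -- combine
  have hA : Real.sqrt (∫ y, w y ^ 2) ≤ ‖(gaussLamGraph lam φ).fst‖ := by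
    rw [← Real.sqrt_sq (norm_nonneg (gaussLamGraph lam φ).fst)]
    exact Real.sqrt_le_sqrt h1
  have hB : Real.sqrt (∫ y, ‖fderiv ℝ w y‖ ^ 2) ≤ Real.sqrt (2 * (‖(gaussLamGraph lam φ).snd‖ ^ 2 +
      (16 / (1 - lam) ^ 2 * ‖(gaussLamGraph lam φ).snd‖ ^ 2 +
        8 / (1 - lam) * ‖(gaussLamGraph lam φ).fst‖ ^ 2))) :=
    Real.sqrt_le_sqrt h2
  exact mul_le_mul (mul_le_mul_of_nonneg_left hA two_pos.le) hB (Real.sqrt_nonneg _) (by positivity)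

end Hardy

/-! ### The Hardy bound on `H¹(μ_λ)` -/

section HardyClosure

variable {lam : ℝ} (hlam : lam ∈ Set.Ico (0 : ℝ) 1)
include hlam

/-- **Hardy bound for `w = ρ_λ u`, `U = (u, ∇u) ∈ H¹(μ_λ)`**: for every `x₀` the function
`(ρ_λu)²/|y − x₀|` is integrable and
`∫ (ρ_λu)²/|y − x₀| ≤ 2‖u‖ (2(‖∇u‖² + (16/(1−λ)²)‖∇u‖² + (8/(1−λ))‖u‖²))^{1/2}`
(norms in `L²(μ_λ)`), by Fatou from the test-function bound along graphs converging to `U`.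
[folklore] -/
theorem integral_sq_weight_div_norm_sub_le_of_mem
    {U : WithLp 2 (Lp ℝ 2 (gaussLamMeasure lam) × Lp (EuclideanSpace ℝ (Fin 2)) 2 (gaussLamMeasure lam))}
    (hU : U ∈ gaussLamFormDomain lam) (x₀ : EuclideanSpace ℝ (Fin 2)) :
    Integrable (fun y : EuclideanSpace ℝ (Fin 2) =>
        (Real.exp (-((1 + lam) / 4 * y 0 ^ 2 + (1 - lam) / 4 * y 1 ^ 2)) *
          (U.fst : EuclideanSpace ℝ (Fin 2) → ℝ) y) ^ 2 / ‖y - x₀‖) ∧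
      ∫ y : EuclideanSpace ℝ (Fin 2),
          (Real.exp (-((1 + lam) / 4 * y 0 ^ 2 + (1 - lam) / 4 * y 1 ^ 2)) *
            (U.fst : EuclideanSpace ℝ (Fin 2) → ℝ) y) ^ 2 / ‖y - x₀‖ ≤
        2 * ‖U.fst‖ * Real.sqrt (2 * (‖U.snd‖ ^ 2 +
          (16 / (1 - lam) ^ 2 * ‖U.snd‖ ^ 2 + 8 / (1 - lam) * ‖U.fst‖ ^ 2))) := by
  have hq : 0 < 1 - lam := by linarith [hlam.2]
  set ρ : EuclideanSpace ℝ (Fin 2) → ℝ := fun y =>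
    Real.exp (-((1 + lam) / 4 * y 0 ^ 2 + (1 - lam) / 4 * y 1 ^ 2)) with hρ_def
  have hρpos : ∀ y, 0 < ρ y := fun y => Real.exp_pos _
  have hρc : Continuous ρ := continuous_expNegQuadLam lam
  obtain ⟨φ, hlim⟩ := exists_seq_tendsto_gaussLamGraph hU
  have h1 : Tendsto (fun n => (gaussLamGraph lam (φ n)).fst) atTop (𝓝 U.fst) :=
    ((WithLp.continuous_fst _ _ _).tendsto U).comp hlim
  have h2 : Tendsto (fun n => (gaussLamGraph lam (φ n)).snd) atTop (𝓝 U.snd) :=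
    ((WithLp.continuous_snd _ _ _).tendsto U).comp hlim
  -- the bounds along the sequence
  set C : ℕ → ℝ := fun n => 2 * ‖(gaussLamGraph lam (φ n)).fst‖ *
    Real.sqrt (2 * (‖(gaussLamGraph lam (φ n)).snd‖ ^ 2 +
      (16 / (1 - lam) ^ 2 * ‖(gaussLamGraph lam (φ n)).snd‖ ^ 2 +
        8 / (1 - lam) * ‖(gaussLamGraph lam (φ n)).fst‖ ^ 2))) with hC_def
  have hCl : Tendsto C atTop (𝓝 (2 * ‖U.fst‖ * Real.sqrt (2 * (‖U.snd‖ ^ 2 +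
      (16 / (1 - lam) ^ 2 * ‖U.snd‖ ^ 2 + 8 / (1 - lam) * ‖U.fst‖ ^ 2))))) :=
    ((h1.norm.const_mul 2).mul ((((h2.norm.pow 2).add (((h2.norm.pow 2).const_mul _).add
      ((h1.norm.pow 2).const_mul _))).const_mul 2).sqrt))
  -- the weight `ρ/|y − x₀|` against `μ_λ`
  set wt : EuclideanSpace ℝ (Fin 2) → ℝ := fun y => ρ y / ‖y - x₀‖ with hwt
  have hwtm : Measurable wt :=
    hρc.measurable.div (continuous_norm.comp (continuous_id.sub continuous_const)).measurable
  have hC : ∀ n, ∫⁻ y, ENNReal.ofReal (wt y *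
      ((gaussLamGraph lam (φ n)).fst : EuclideanSpace ℝ (Fin 2) → ℝ) y ^ 2) ∂gaussLamMeasure lam ≤
      ENNReal.ofReal (C n) := by
    intro n
    obtain ⟨hintn, hlen⟩ := integral_sq_weight_div_norm_sub_le_graph hlam (φ n) x₀
    have hae := MemLp.coeFn_toLp (memLp_planarTestFunction lam (φ n))
    -- integrability of `wt φ²` against `μ_λ`
    have hintμ : Integrable (fun y => wt y * (φ n : EuclideanSpace ℝ (Fin 2) → ℝ) y ^ 2)
        (gaussLamMeasure lam) := by
      rw [integrable_gaussLamMeasure_iff]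
      refine hintn.congr (Eventually.of_forall fun y => ?_)
      show (ρ y * (φ n : EuclideanSpace ℝ (Fin 2) → ℝ) y) ^ 2 / ‖y - x₀‖ =
        ρ y / ‖y - x₀‖ * (φ n : EuclideanSpace ℝ (Fin 2) → ℝ) y ^ 2 * ρ y
      ring
    have heq : ∫ y, wt y * (φ n : EuclideanSpace ℝ (Fin 2) → ℝ) y ^ 2 ∂gaussLamMeasure lam =
        ∫ y, (ρ y * (φ n : EuclideanSpace ℝ (Fin 2) → ℝ) y) ^ 2 / ‖y - x₀‖ := by
      rw [integral_gaussLamMeasure]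
      refine integral_congr_ae (Eventually.of_forall fun y => ?_)
      show ρ y / ‖y - x₀‖ * (φ n : EuclideanSpace ℝ (Fin 2) → ℝ) y ^ 2 * ρ y =
        (ρ y * (φ n : EuclideanSpace ℝ (Fin 2) → ℝ) y) ^ 2 / ‖y - x₀‖
      ring
    calc ∫⁻ y, ENNReal.ofReal (wt y *
          ((gaussLamGraph lam (φ n)).fst : EuclideanSpace ℝ (Fin 2) → ℝ) y ^ 2) ∂gaussLamMeasure lam
        = ∫⁻ y, ENNReal.ofReal (wt y * (φ n : EuclideanSpace ℝ (Fin 2) → ℝ) y ^ 2)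
            ∂gaussLamMeasure lam := by
          refine lintegral_congr_ae ?_
          filter_upwards [hae] with y hy
          rw [gaussLamGraph_fst, hy]
      _ = ENNReal.ofReal (∫ y, wt y * (φ n : EuclideanSpace ℝ (Fin 2) → ℝ) y ^ 2
            ∂gaussLamMeasure lam) :=
          (ofReal_integral_eq_lintegral_ofReal hintμ (Eventually.of_forall fun y =>
            mul_nonneg (div_nonneg (hρpos y).le (norm_nonneg _)) (sq_nonneg _))).symm
      _ ≤ ENNReal.ofReal (C n) := by rw [heq]; exact ENNReal.ofReal_le_ofReal hlen
  have key := lintegral_weight_mul_sq_le_of_tendsto_Lp h1 hwtm hC hCl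
  -- conclusion
  set c : ℝ := 2 * ‖U.fst‖ * Real.sqrt (2 * (‖U.snd‖ ^ 2 +
    (16 / (1 - lam) ^ 2 * ‖U.snd‖ ^ 2 + 8 / (1 - lam) * ‖U.fst‖ ^ 2))) with hc_def
  have hc0 : 0 ≤ c := by positivity
  have hmeas : AEStronglyMeasurable (fun y : EuclideanSpace ℝ (Fin 2) =>
      wt y * (U.fst : EuclideanSpace ℝ (Fin 2) → ℝ) y ^ 2) (gaussLamMeasure lam) :=
    hwtm.aestronglyMeasurable.mul ((Lp.aestronglyMeasurable _).pow 2)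
  have hnn : 0 ≤ᵐ[gaussLamMeasure lam] fun y : EuclideanSpace ℝ (Fin 2) =>
      wt y * (U.fst : EuclideanSpace ℝ (Fin 2) → ℝ) y ^ 2 :=
    Eventually.of_forall fun y => mul_nonneg (div_nonneg (hρpos y).le (norm_nonneg _)) (sq_nonneg _)
  have hintμ : Integrable (fun y : EuclideanSpace ℝ (Fin 2) =>
      wt y * (U.fst : EuclideanSpace ℝ (Fin 2) → ℝ) y ^ 2) (gaussLamMeasure lam) := by
    refine ⟨hmeas, ?_⟩
    rw [hasFiniteIntegral_iff_enorm]
    calc ∫⁻ y, ‖wt y * (U.fst : EuclideanSpace ℝ (Fin 2) → ℝ) y ^ 2‖ₑ ∂gaussLamMeasure lam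
        = ∫⁻ y, ENNReal.ofReal (wt y * (U.fst : EuclideanSpace ℝ (Fin 2) → ℝ) y ^ 2)
            ∂gaussLamMeasure lam :=
          lintegral_congr fun y => Real.enorm_eq_ofReal
            (mul_nonneg (div_nonneg (hρpos y).le (norm_nonneg _)) (sq_nonneg _))
      _ ≤ _ := key
      _ < ⊤ := ENNReal.ofReal_lt_top
  have hintdx := (integrable_gaussLamMeasure_iff lam).1 hintμ
  refine ⟨hintdx.congr (Eventually.of_forall fun y => ?_), ?_⟩
  · show ρ y / ‖y - x₀‖ * (U.fst : EuclideanSpace ℝ (Fin 2) → ℝ) y ^ 2 * ρ y =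
      (ρ y * (U.fst : EuclideanSpace ℝ (Fin 2) → ℝ) y) ^ 2 / ‖y - x₀‖
    ring
  · have heq : ∫ y, (ρ y * (U.fst : EuclideanSpace ℝ (Fin 2) → ℝ) y) ^ 2 / ‖y - x₀‖ =
        ∫ y, wt y * (U.fst : EuclideanSpace ℝ (Fin 2) → ℝ) y ^ 2 ∂gaussLamMeasure lam := by
      rw [integral_gaussLamMeasure]
      refine integral_congr_ae (Eventually.of_forall fun y => ?_)
      show (ρ y * (U.fst : EuclideanSpace ℝ (Fin 2) → ℝ) y) ^ 2 / ‖y - x₀‖ =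
        ρ y / ‖y - x₀‖ * (U.fst : EuclideanSpace ℝ (Fin 2) → ℝ) y ^ 2 * ρ y
      ring
    rw [heq, integral_eq_lintegral_of_nonneg_ae hnn hmeas]
    exact ENNReal.toReal_le_of_le_ofReal hc0 key

end HardyClosure

/-! ### The Biot–Savart integral of `w = ρ_λ u` -/

section BiotSavart

variable {lam : ℝ} (hlam : lam ∈ Set.Ico (0 : ℝ) 1)
include hlam

/-- **`w = ρ_λ u ∈ L¹` with `‖w‖_{L¹} ≤ (∫ρ_λ)^{1/2} ‖u‖_{L²(μ_λ)}`** for `u ∈ L²(μ_λ)`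
(Cauchy–Schwarz in `L²(μ_λ)`). [folklore] -/
theorem integrable_weight_mul_Lp (u : Lp ℝ 2 (gaussLamMeasure lam)) :
    Integrable (fun y : EuclideanSpace ℝ (Fin 2) =>
        Real.exp (-((1 + lam) / 4 * y 0 ^ 2 + (1 - lam) / 4 * y 1 ^ 2)) *
          (u : EuclideanSpace ℝ (Fin 2) → ℝ) y) ∧
      ∫ y : EuclideanSpace ℝ (Fin 2), |Real.exp (-((1 + lam) / 4 * y 0 ^ 2 + (1 - lam) / 4 * y 1 ^ 2)) *
          (u : EuclideanSpace ℝ (Fin 2) → ℝ) y| ≤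
        Real.sqrt (∫ y : EuclideanSpace ℝ (Fin 2),
          Real.exp (-((1 + lam) / 4 * y 0 ^ 2 + (1 - lam) / 4 * y 1 ^ 2))) * ‖u‖ := by
  haveI := isFiniteMeasure_gaussLamMeasure hlam
  set ρ : EuclideanSpace ℝ (Fin 2) → ℝ := fun y =>
    Real.exp (-((1 + lam) / 4 * y 0 ^ 2 + (1 - lam) / 4 * y 1 ^ 2)) with hρ_def
  have hρpos : ∀ y, 0 < ρ y := fun y => Real.exp_pos _
  have hρc : Continuous ρ := continuous_expNegQuadLam lam
  have hρi : Integrable ρ := integrable_expNegQuadLam hlam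
  have hum : AEStronglyMeasurable (u : EuclideanSpace ℝ (Fin 2) → ℝ) volume :=
    (Lp.aestronglyMeasurable u).mono_ac (absolutelyContinuous_gaussLamMeasure lam)
  have hu2 : Integrable fun y => (u : EuclideanSpace ℝ (Fin 2) → ℝ) y ^ 2 * ρ y := by
    have h := (memLp_two_iff_integrable_sq (Lp.aestronglyMeasurable u)).1 (Lp.memLp u)
    rwa [integrable_gaussLamMeasure_iff] at h
  -- integrability by AM–GM `|ρu| ≤ (ρ + ρu²)/2`
  have hint : Integrable fun y => ρ y * (u : EuclideanSpace ℝ (Fin 2) → ℝ) y := by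
    refine Integrable.mono' ((hρi.add hu2).div_const 2) (hρc.aestronglyMeasurable.mul hum)
      (Eventually.of_forall fun y => ?_)
    rw [Real.norm_eq_abs, abs_mul, abs_of_pos (hρpos y), Pi.add_apply]
    have := hρpos y
    nlinarith [sq_nonneg (|(u : EuclideanSpace ℝ (Fin 2) → ℝ) y| - 1), sq_abs ((u : EuclideanSpace ℝ (Fin 2) → ℝ) y),
      mul_nonneg this.le (sq_nonneg (|(u : EuclideanSpace ℝ (Fin 2) → ℝ) y| - 1))]
  refine ⟨hint, ?_⟩
  -- Cauchy–Schwarz against `μ_λ`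
  have hpq : (2 : ℝ).HolderConjugate 2 := by rw [Real.holderConjugate_iff]; norm_num
  have hCS := integral_mul_le_Lp_mul_Lq_of_nonneg (μ := gaussLamMeasure lam) hpq
    (f := fun _ => (1 : ℝ)) (g := fun y => |(u : EuclideanSpace ℝ (Fin 2) → ℝ) y|)
    (Eventually.of_forall fun _ => zero_le_one) (Eventually.of_forall fun _ => abs_nonneg _)
    (by simpa using (memLp_const (1 : ℝ) : MemLp (fun _ : EuclideanSpace ℝ (Fin 2) => (1 : ℝ)) 2
      (gaussLamMeasure lam)))
    (by rw [ENNReal.ofReal_ofNat]; exact (Lp.memLp u).abs)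
  have e0 : ∫ y, |ρ y * (u : EuclideanSpace ℝ (Fin 2) → ℝ) y| =
      ∫ y, (1 : ℝ) * |(u : EuclideanSpace ℝ (Fin 2) → ℝ) y| ∂gaussLamMeasure lam := by
    rw [integral_gaussLamMeasure]
    refine integral_congr_ae (Eventually.of_forall fun y => ?_)
    show |ρ y * (u : EuclideanSpace ℝ (Fin 2) → ℝ) y| = 1 * |(u : EuclideanSpace ℝ (Fin 2) → ℝ) y| * ρ y
    rw [abs_mul, abs_of_pos (hρpos y)]; ring
  have e1 : (∫ y, (1 : ℝ) ^ (2 : ℝ) ∂gaussLamMeasure lam) ^ (1 / (2 : ℝ)) = Real.sqrt (∫ y, ρ y) := by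
    rw [Real.sqrt_eq_rpow]
    congr 1
    rw [integral_gaussLamMeasure]
    exact integral_congr_ae (Eventually.of_forall fun y => by dsimp only; rw [Real.one_rpow, one_mul])
  have e2 : (∫ y, |(u : EuclideanSpace ℝ (Fin 2) → ℝ) y| ^ (2 : ℝ) ∂gaussLamMeasure lam) ^ (1 / (2 : ℝ)) = ‖u‖ := by
    rw [← Real.sqrt_eq_rpow]
    have h : ∫ y, |(u : EuclideanSpace ℝ (Fin 2) → ℝ) y| ^ (2 : ℝ) ∂gaussLamMeasure lam = ‖u‖ ^ 2 := by
      rw [norm_sq_Lp_two_eq_integral]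
      exact integral_congr_ae (Eventually.of_forall fun y => by dsimp only; rw [Real.rpow_two, sq_abs])
    rw [h, Real.sqrt_sq (norm_nonneg _)]
  rw [e0, ← e1, ← e2]
  exact hCS

omit hlam in
/-- **Pointwise majorant of the Biot–Savart integrand** with a free parameter `t > 0`:
`|w| (2π|z|)⁻¹ ≤ (2π)⁻¹ ((t w²/|z| + t⁻¹ 𝟙_{|z|<1}|z|⁻¹)/2 + |w|)` (AM–GM on the unit disc,
`|z|⁻¹ ≤ 1` outside). [folklore] -/
theorem abs_mul_norm_biotSavartKernel2D_le {t : ℝ} (ht : 0 < t) (wv : ℝ) (z : EuclideanSpace ℝ (Fin 2)) :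
    |wv| * ((2 * Real.pi)⁻¹ * ‖z‖⁻¹) ≤ (2 * Real.pi)⁻¹ *
      ((t * (wv ^ 2 * ‖z‖⁻¹) + t⁻¹ * indicator (ball (0 : EuclideanSpace ℝ (Fin 2)) 1)
        (fun z => ‖z‖⁻¹) z) / 2 + |wv|) := by
  have hπ : 0 < (2 * Real.pi)⁻¹ := by positivity
  have hr0 : 0 ≤ ‖z‖⁻¹ := inv_nonneg.2 (norm_nonneg _)
  have hw0 : 0 ≤ |wv| := abs_nonneg _
  rw [mul_comm |wv|, mul_assoc]
  refine mul_le_mul_of_nonneg_left ?_ hπ.le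
  -- AM–GM: `2|w| ≤ t w² + t⁻¹`
  have hamgm : 2 * |wv| ≤ t * wv ^ 2 + t⁻¹ := by
    have h1 : 0 ≤ (t * |wv| - 1) ^ 2 / t := by positivity
    have h2 : (t * |wv| - 1) ^ 2 / t = t * |wv| ^ 2 - 2 * |wv| + t⁻¹ := by
      field_simp
      ring
    rw [h2, sq_abs] at h1
    linarith
  by_cases hz : ‖z‖ < 1
  · rw [indicator_of_mem (mem_ball_zero_iff.2 hz)]
    have := mul_le_mul_of_nonneg_left hamgm hr0
    nlinarith [this, hr0, hw0]
  · rw [indicator_of_notMem (by rwa [mem_ball_zero_iff])]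
    have hr1 : ‖z‖⁻¹ ≤ 1 := inv_le_one_of_one_le₀ (not_lt.1 hz)
    have h1 : ‖z‖⁻¹ * |wv| ≤ |wv| := by nlinarith
    have h2 : 0 ≤ t * (wv ^ 2 * ‖z‖⁻¹) := by positivity
    nlinarith

/-- **The Biot–Savart integral of `w = ρ_λ u`, `U = (u, ∇u) ∈ H¹(μ_λ)`, converges absolutely at every
point**: `y ↦ w(y) K_{2D}(x₀ − y)` is integrable for every `x₀` (majorant from
`abs_mul_norm_biotSavartKernel2D_le` with `t = 1`: the Hardy bound, `∫_{B₁}|z|⁻¹ < ∞` and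
`w ∈ L¹`). [folklore] -/
theorem integrable_weight_mul_smul_biotSavartKernel2D
    {U : WithLp 2 (Lp ℝ 2 (gaussLamMeasure lam) × Lp (EuclideanSpace ℝ (Fin 2)) 2 (gaussLamMeasure lam))}
    (hU : U ∈ gaussLamFormDomain lam) (x₀ : EuclideanSpace ℝ (Fin 2)) :
    Integrable fun y : EuclideanSpace ℝ (Fin 2) =>
      (Real.exp (-((1 + lam) / 4 * y 0 ^ 2 + (1 - lam) / 4 * y 1 ^ 2)) *
        (U.fst : EuclideanSpace ℝ (Fin 2) → ℝ) y) • biotSavartKernel2D (x₀ - y) := by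
  set w : EuclideanSpace ℝ (Fin 2) → ℝ := fun y =>
    Real.exp (-((1 + lam) / 4 * y 0 ^ 2 + (1 - lam) / 4 * y 1 ^ 2)) *
      (U.fst : EuclideanSpace ℝ (Fin 2) → ℝ) y with hw_def
  obtain ⟨hHi, -⟩ := integral_sq_weight_div_norm_sub_le_of_mem hlam hU x₀
  obtain ⟨hwi, -⟩ := integrable_weight_mul_Lp hlam U.fst
  have hmeas : AEStronglyMeasurable (fun y => w y • biotSavartKernel2D (x₀ - y)) volume :=
    hwi.aestronglyMeasurable.smul
      (measurable_biotSavartKernel2D.comp (measurable_const.sub measurable_id)).aestronglyMeasurable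
  have hg : Integrable fun y => (2 * Real.pi)⁻¹ *
      ((1 * (w y ^ 2 * ‖x₀ - y‖⁻¹) + (1 : ℝ)⁻¹ * indicator (ball (0 : EuclideanSpace ℝ (Fin 2)) 1)
        (fun z => ‖z‖⁻¹) (x₀ - y)) / 2 + |w y|) := by
    have h1 : Integrable fun y => 1 * (w y ^ 2 * ‖x₀ - y‖⁻¹) := by
      refine (hHi.congr (Eventually.of_forall fun y => ?_)).const_mul 1
      show w y ^ 2 / ‖y - x₀‖ = w y ^ 2 * ‖x₀ - y‖⁻¹
      rw [div_eq_mul_inv, norm_sub_rev]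
    exact (((h1.add ((integrable_indicator_inv_norm.comp_sub_left x₀).const_mul _)).div_const 2).add
      hwi.abs).const_mul _
  refine hg.mono' hmeas (Eventually.of_forall fun y => ?_)
  rw [norm_smul, Real.norm_eq_abs, norm_biotSavartKernel2D]
  exact abs_mul_norm_biotSavartKernel2D_le one_pos (w y) (x₀ - y)

omit hlam in
/-- `‖u‖ ≤ ‖(u, G)‖` and `‖G‖ ≤ ‖(u, G)‖` for the `ℓ²`-product norm. [folklore] -/
theorem norm_fst_le_and_norm_snd_le
    (U : WithLp 2 (Lp ℝ 2 (gaussLamMeasure lam) × Lp (EuclideanSpace ℝ (Fin 2)) 2 (gaussLamMeasure lam))) :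
    ‖U.fst‖ ≤ ‖U‖ ∧ ‖U.snd‖ ≤ ‖U‖ := by
  have h := WithLp.prod_norm_sq_eq_of_L2 U
  constructor
  · nlinarith [norm_nonneg U, norm_nonneg U.fst, sq_nonneg ‖U.snd‖]
  · nlinarith [norm_nonneg U, norm_nonneg U.snd, sq_nonneg ‖U.fst‖]

/-- **Uniform `L¹` bound of the Biot–Savart integrand of `w = ρ_λ u`, linear in `‖U‖_{H¹(μ_λ)}`**:
`∫ ‖w(y) K_{2D}(x₀ − y)‖ dy ≤ (2π)⁻¹ ((a_λ + I₁)/2 + (∫ρ_λ)^{1/2}) ‖U‖` for every `x₀`, where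
`a_λ = 2 (2(1 + 16/(1−λ)² + 8/(1−λ)))^{1/2}` and `I₁ = ∫_{|z|<1} |z|⁻¹ dz` (the majorant
`abs_mul_norm_biotSavartKernel2D_le` with `t = ‖U‖⁻¹`, the Hardy bound, and `‖w‖_{L¹} ≤ (∫ρ)^{1/2}‖u‖`).
[folklore] -/
theorem integral_norm_weight_mul_smul_biotSavartKernel2D_le
    {U : WithLp 2 (Lp ℝ 2 (gaussLamMeasure lam) × Lp (EuclideanSpace ℝ (Fin 2)) 2 (gaussLamMeasure lam))}
    (hU : U ∈ gaussLamFormDomain lam) (x₀ : EuclideanSpace ℝ (Fin 2)) :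
    ∫ y, ‖(Real.exp (-((1 + lam) / 4 * y 0 ^ 2 + (1 - lam) / 4 * y 1 ^ 2)) *
          (U.fst : EuclideanSpace ℝ (Fin 2) → ℝ) y) • biotSavartKernel2D (x₀ - y)‖ ≤
      (2 * Real.pi)⁻¹ * ((2 * Real.sqrt (2 * (1 + 16 / (1 - lam) ^ 2 + 8 / (1 - lam))) +
          ∫ z, indicator (ball (0 : EuclideanSpace ℝ (Fin 2)) 1) (fun z => ‖z‖⁻¹) z) / 2 +
        Real.sqrt (∫ y : EuclideanSpace ℝ (Fin 2),
          Real.exp (-((1 + lam) / 4 * y 0 ^ 2 + (1 - lam) / 4 * y 1 ^ 2)))) * ‖U‖ := by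
  have hq : 0 < 1 - lam := by linarith [hlam.2]
  set w : EuclideanSpace ℝ (Fin 2) → ℝ := fun y =>
    Real.exp (-((1 + lam) / 4 * y 0 ^ 2 + (1 - lam) / 4 * y 1 ^ 2)) *
      (U.fst : EuclideanSpace ℝ (Fin 2) → ℝ) y with hw_def
  set I₁ : ℝ := ∫ z, indicator (ball (0 : EuclideanSpace ℝ (Fin 2)) 1) (fun z => ‖z‖⁻¹) z with hI₁
  set Z : ℝ := ∫ y : EuclideanSpace ℝ (Fin 2),
    Real.exp (-((1 + lam) / 4 * y 0 ^ 2 + (1 - lam) / 4 * y 1 ^ 2)) with hZ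
  set k : ℝ := 1 + 16 / (1 - lam) ^ 2 + 8 / (1 - lam) with hk
  have hk0 : 0 ≤ k := by positivity
  have hI₁0 : 0 ≤ I₁ := integral_nonneg indicator_inv_norm_nonneg
  have hπ : 0 < (2 * Real.pi)⁻¹ := by positivity
  by_cases hU0 : U = 0
  · -- `U = 0`: `w = 0` a.e.
    have hfst : (U.fst : EuclideanSpace ℝ (Fin 2) → ℝ) =ᵐ[volume] 0 := by
      rw [hU0]
      exact (ae_gaussLamMeasure_iff lam).1 (Lp.coeFn_zero ℝ 2 (gaussLamMeasure lam))
    have hw0 : ∫ y, ‖w y • biotSavartKernel2D (x₀ - y)‖ = 0 := by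
      rw [← integral_zero]
      refine integral_congr_ae ?_
      filter_upwards [hfst] with y hy
      simp [hw_def, hy]
    rw [hw0]
    positivity
  -- `U ≠ 0`
  have hN : 0 < ‖U‖ := norm_pos_iff.2 hU0
  obtain ⟨hfstle, hsndle⟩ := norm_fst_le_and_norm_snd_le (lam := lam) U
  obtain ⟨hHi, hHle⟩ := integral_sq_weight_div_norm_sub_le_of_mem hlam hU x₀
  obtain ⟨hwi, hL⟩ := integrable_weight_mul_Lp hlam U.fst
  set t : ℝ := ‖U‖⁻¹ with ht_def
  have ht : 0 < t := by positivity
  have hA : Integrable fun y => t * (w y ^ 2 * ‖x₀ - y‖⁻¹) := by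
    refine (hHi.congr (Eventually.of_forall fun y => ?_)).const_mul t
    show w y ^ 2 / ‖y - x₀‖ = w y ^ 2 * ‖x₀ - y‖⁻¹
    rw [div_eq_mul_inv, norm_sub_rev]
  have hB : Integrable fun y => t⁻¹ * indicator (ball (0 : EuclideanSpace ℝ (Fin 2)) 1)
      (fun z => ‖z‖⁻¹) (x₀ - y) :=
    (integrable_indicator_inv_norm.comp_sub_left x₀).const_mul _
  have hAB : Integrable fun y => t * (w y ^ 2 * ‖x₀ - y‖⁻¹) + t⁻¹ *
      indicator (ball (0 : EuclideanSpace ℝ (Fin 2)) 1) (fun z => ‖z‖⁻¹) (x₀ - y) := hA.add hB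
  have hAB2 : Integrable fun y => (t * (w y ^ 2 * ‖x₀ - y‖⁻¹) + t⁻¹ *
      indicator (ball (0 : EuclideanSpace ℝ (Fin 2)) 1) (fun z => ‖z‖⁻¹) (x₀ - y)) / 2 :=
    hAB.div_const 2
  have hwa : Integrable fun y => |w y| := hwi.abs
  have hmaj : Integrable fun y => (2 * Real.pi)⁻¹ *
      ((t * (w y ^ 2 * ‖x₀ - y‖⁻¹) + t⁻¹ * indicator (ball (0 : EuclideanSpace ℝ (Fin 2)) 1)
        (fun z => ‖z‖⁻¹) (x₀ - y)) / 2 + |w y|) := (hAB2.add hwa).const_mul _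
  -- Step 1: integrate the pointwise majorant
  have hstep1 : ∫ y, ‖w y • biotSavartKernel2D (x₀ - y)‖ ≤ (2 * Real.pi)⁻¹ *
      ((t * (∫ y, w y ^ 2 * ‖x₀ - y‖⁻¹) + t⁻¹ * I₁) / 2 + ∫ y, |w y|) := by
    have hle := integral_mono_of_nonneg (Eventually.of_forall fun y => norm_nonneg _) hmaj
      (Eventually.of_forall fun y => (?_ : ‖w y • biotSavartKernel2D (x₀ - y)‖ ≤ _))
    · refine hle.trans (le_of_eq ?_)
      rw [integral_const_mul, integral_add hAB2 hwa, integral_div, integral_add hA hB,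
        integral_const_mul, integral_const_mul, hI₁,
        integral_sub_left_eq_self (indicator (ball (0 : EuclideanSpace ℝ (Fin 2)) 1) fun z => ‖z‖⁻¹)
          volume x₀]
    · rw [norm_smul, Real.norm_eq_abs, norm_biotSavartKernel2D]
      exact abs_mul_norm_biotSavartKernel2D_le ht (w y) (x₀ - y)
  -- Step 2: the three integrals in terms of `‖U‖`
  have hAle : ∫ y, w y ^ 2 * ‖x₀ - y‖⁻¹ ≤ 2 * Real.sqrt (2 * k) * ‖U‖ ^ 2 := by
    have heq : ∫ y, w y ^ 2 * ‖x₀ - y‖⁻¹ = ∫ y, w y ^ 2 / ‖y - x₀‖ :=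
      integral_congr_ae (Eventually.of_forall fun y => by
        show w y ^ 2 * ‖x₀ - y‖⁻¹ = w y ^ 2 / ‖y - x₀‖
        rw [div_eq_mul_inv, norm_sub_rev])
    rw [heq]
    refine hHle.trans ?_
    have h1 : Real.sqrt (2 * (‖U.snd‖ ^ 2 + (16 / (1 - lam) ^ 2 * ‖U.snd‖ ^ 2 +
        8 / (1 - lam) * ‖U.fst‖ ^ 2))) ≤ Real.sqrt (2 * k) * ‖U‖ := by
      rw [← Real.sqrt_sq hN.le, ← Real.sqrt_mul (by positivity)]
      refine Real.sqrt_le_sqrt ?_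
      rw [hk]
      have h2 : ‖U.fst‖ ^ 2 ≤ ‖U‖ ^ 2 := pow_le_pow_left₀ (norm_nonneg _) hfstle 2
      have h3 : ‖U.snd‖ ^ 2 ≤ ‖U‖ ^ 2 := pow_le_pow_left₀ (norm_nonneg _) hsndle 2
      have h4 : 16 / (1 - lam) ^ 2 * ‖U.snd‖ ^ 2 ≤ 16 / (1 - lam) ^ 2 * ‖U‖ ^ 2 :=
        mul_le_mul_of_nonneg_left h3 (by positivity)
      have h5 : 8 / (1 - lam) * ‖U.fst‖ ^ 2 ≤ 8 / (1 - lam) * ‖U‖ ^ 2 :=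
        mul_le_mul_of_nonneg_left h2 (by positivity)
      nlinarith
    calc 2 * ‖U.fst‖ * Real.sqrt (2 * (‖U.snd‖ ^ 2 + (16 / (1 - lam) ^ 2 * ‖U.snd‖ ^ 2 +
          8 / (1 - lam) * ‖U.fst‖ ^ 2)))
        ≤ 2 * ‖U‖ * (Real.sqrt (2 * k) * ‖U‖) :=
          mul_le_mul (mul_le_mul_of_nonneg_left hfstle two_pos.le) h1 (Real.sqrt_nonneg _) (by positivity)
      _ = 2 * Real.sqrt (2 * k) * ‖U‖ ^ 2 := by ring
  have hLle : ∫ y, |w y| ≤ Real.sqrt Z * ‖U‖ :=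
    hL.trans (mul_le_mul_of_nonneg_left hfstle (Real.sqrt_nonneg _))
  have htA : t * (∫ y, w y ^ 2 * ‖x₀ - y‖⁻¹) ≤ 2 * Real.sqrt (2 * k) * ‖U‖ := by
    calc t * (∫ y, w y ^ 2 * ‖x₀ - y‖⁻¹) ≤ t * (2 * Real.sqrt (2 * k) * ‖U‖ ^ 2) :=
          mul_le_mul_of_nonneg_left hAle ht.le
      _ = 2 * Real.sqrt (2 * k) * ‖U‖ := by rw [ht_def]; field_simp
  have htB : t⁻¹ * I₁ = I₁ * ‖U‖ := by rw [ht_def, inv_inv]; ring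
  calc ∫ y, ‖w y • biotSavartKernel2D (x₀ - y)‖ ≤ (2 * Real.pi)⁻¹ *
        ((t * (∫ y, w y ^ 2 * ‖x₀ - y‖⁻¹) + t⁻¹ * I₁) / 2 + ∫ y, |w y|) := hstep1
    _ ≤ (2 * Real.pi)⁻¹ * ((2 * Real.sqrt (2 * k) * ‖U‖ + I₁ * ‖U‖) / 2 + Real.sqrt Z * ‖U‖) := by
        rw [htB]
        gcongr
    _ = (2 * Real.pi)⁻¹ * ((2 * Real.sqrt (2 * k) + I₁) / 2 + Real.sqrt Z) * ‖U‖ := by ring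

/-- **`L^∞` bound of the Biot–Savart velocity of `w = ρ_λ u`, linear in `‖U‖_{H¹(μ_λ)}`**:
`‖(K_{2D} ∗ w)(x₀)‖ ≤ (2π)⁻¹ ((a_λ + I₁)/2 + (∫ρ_λ)^{1/2}) ‖U‖` for every `x₀`
(`integral_norm_weight_mul_smul_biotSavartKernel2D_le` and `‖∫·‖ ≤ ∫‖·‖`). In particular
`U ↦ K_{2D} ∗ (ρ_λ u)` maps `H¹(μ_λ)` boundedly into bounded velocity fields. [folklore] -/
theorem norm_biotSavart2D_weight_mul_le
    {U : WithLp 2 (Lp ℝ 2 (gaussLamMeasure lam) × Lp (EuclideanSpace ℝ (Fin 2)) 2 (gaussLamMeasure lam))}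
    (hU : U ∈ gaussLamFormDomain lam) (x₀ : EuclideanSpace ℝ (Fin 2)) :
    ‖biotSavart2D (fun y : EuclideanSpace ℝ (Fin 2) =>
        Real.exp (-((1 + lam) / 4 * y 0 ^ 2 + (1 - lam) / 4 * y 1 ^ 2)) *
          (U.fst : EuclideanSpace ℝ (Fin 2) → ℝ) y) x₀‖ ≤
      (2 * Real.pi)⁻¹ * ((2 * Real.sqrt (2 * (1 + 16 / (1 - lam) ^ 2 + 8 / (1 - lam))) +
          ∫ z, indicator (ball (0 : EuclideanSpace ℝ (Fin 2)) 1) (fun z => ‖z‖⁻¹) z) / 2 +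
        Real.sqrt (∫ y : EuclideanSpace ℝ (Fin 2),
          Real.exp (-((1 + lam) / 4 * y 0 ^ 2 + (1 - lam) / 4 * y 1 ^ 2)))) * ‖U‖ := by
  unfold biotSavart2D
  exact (norm_integral_le_integral_norm _).trans
    (integral_norm_weight_mul_smul_biotSavartKernel2D_le hlam hU x₀)

end BiotSavart

end Literature.Analysis.FluidPDE
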